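import Literature.Claims.NS.Stanley2025
import Literature.Analysis.FunctionSpaces.TorusFourierModes
import Literature.Analysis.FunctionSpaces.TorusScalarTrigPoly
import Literature.Analysis.FunctionSpaces.TorusCalculusProofs
import HarnessLib

/-!
# C85 `Stanley2025` — companion refutation of Lemma 14 p.26 itself at its field-level grain `Step_L14Abs`

Cell `ns-claims` (D-0090), claim C85; skeleton `Literature.Claims.NS.Stanley2025` (p482596 typist-7 g2,
rev 2 p486662). Text of record: M. Stanley, *Uniform H¹ Control and Global Regularity for the 3-D
Navier–Stokes Equations*, OSF Preprints 8hv92 v1 (2025) [Stanley2025], Lemma 14 p.26 «Let u(t,x) be a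
smooth divergence-free solution of Navier–Stokes on 𝕋³. Then I_conv + I_press = 0», where
`I_conv = −∫ 2F′_η(|u|²) uᵢuⱼ∂ⱼuᵢ`, `I_press = −∫ 2F′_η(|u|²) uᵢ∂ᵢp`, `F′_η(s) = ln(1 + s/η)` (Lemma 11(2)
p.23). The row is ADJUDICATED #96 on the record file `SoloRefuteStanley2025.lean` (p488712, Proposition 2
Step 1; untouched here) with locator Step 1 = `Step_L14` = Lemma 14 p.26. This SEPARATE companion module
(refuter of record ns-claims-refuter-6; filed by the salvage lane, conv. (b)) gives the kernel face at the
field-level grain `Step_L14Abs` (HYGIENE 13, referee ns-claims-ref-1 g2): «for every η > 0, every smooth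
divergence-free u on 𝕋³ and every smooth p with Δp = −div((u·∇)u), I_conv + I_press = 0» is false.

WHAT IS PROVED: `not_Step_L14Abs : ¬ Literature.Claims.NS.Stanley2025.Step_L14Abs`. Witness (`X = 2πx₁`,
`Y = 2πx₂`): the planar cellular flow with a passive third component `u0 = (sin Y, sin X, cos X + cos(X+Y))`
and its exact pressure `p0 = cos X cos Y` — smooth, divergence-free (`L14.u0_divFree`),
`Δp0 = −div((u0·∇)u0)` (`L14.poisson`, via the six-mode expansion `L14.convect_eq`). With `q = |u0|²` and
`m = u0·((u0·∇)u0) + u0·∇p0`, `I_conv + I_press = −∫ 2 ln(1 + q/η) m`; the exact mean `∫ q·m = π/4`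
(`L14.integral_F`, from the 64-character expansion `L14.F_expansion`, a Laurent-polynomial identity in
`e^{iX}, e^{iY}` closed by `ring`), `0 ≤ q ≤ 6`, `|m| ≤ 12π` and `s − s² ≤ ln(1+s) ≤ s` give
`∫ 2 ln(1 + q/η) m ≥ (2/η)(π/4) − (2/η²)·432π > 0` at `η = 10⁴`. (To first order in `1/η` the lemma says
`∫ |u|² u·∇p = 0`, i.e. `∫ p u·∇|u|² = 0`, which fails; the convective part does vanish.)
Closed term; axioms `propext`, `Classical.choice`, `Quot.sound`.

WHAT THIS IS NOT: not a claim about NS regularity or blow-up; not a claim about any author beyond the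
typed locator.
-/

-- The summit's canonical theorem namespace repeats the summit name (single-conjunct summit).
set_option linter.dupNamespace false

noncomputable section
open Set Function MeasureTheory Filter Topology UnitAddTorus
open scoped ContDiff RealInnerProductSpace InnerProductSpace ComplexConjugate

namespace Summit.NavierStokesRegularity.NavierStokesRegularity.Theorems.Stanley2025

open Literature.Analysis.FunctionSpaces Literature.Analysis.FunctionSpaces.Torus
  Literature.Claims.NS.Stanley2025

namespace L14
/-- the basic characters `w x i = e^{2πi x_i}` -/
def w (x : T3) (i : Fin 3) : ℂ := (AddCircle.toCircle (x i) : ℂ)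
/-- Characters do not vanish. -/
theorem w_ne_zero (x : T3) (i : Fin 3) : w x i ≠ 0 := Circle.coe_ne_zero _
/-- `conj w = w⁻¹` on the unit circle. -/
theorem conj_w (x : T3) (i : Fin 3) : conj (w x i) = (w x i)⁻¹ := by
  rw [w, ← Circle.coe_inv_eq_conj]
  simp
/-- Every character of `𝕋³` is a Laurent monomial in `w x 0, w x 1, w x 2`. -/
theorem mFourier_eq_w (n : Fin 3 → ℤ) (x : T3) :
    mFourier n x = w x 0 ^ n 0 * w x 1 ^ n 1 * w x 2 ^ n 2 := by
  simp only [mFourier, ContinuousMap.coe_mk, fourier_apply, AddCircle.toCircle_zsmul,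
    Circle.coe_zpow, Fin.prod_univ_three, w]
/-- Frequency `(1,0,0)` (character `e^{2πi x₁}`). -/ def k1 : Fin 3 → ℤ := ![1, 0, 0]
/-- Frequency `(0,1,0)`. -/ def k2 : Fin 3 → ℤ := ![0, 1, 0]
/-- Frequency `(1,1,0)`. -/ def k3 : Fin 3 → ℤ := ![1, 1, 0]
/-- Frequency `(1,-1,0)`. -/ def k4 : Fin 3 → ℤ := ![1, -1, 0]
/-- Frequency `(1,2,0)`. -/ def k5 : Fin 3 → ℤ := ![1, 2, 0]
/-- Frequency `(2,1,0)`. -/ def k6 : Fin 3 → ℤ := ![2, 1, 0]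
/-- The velocity spectrum `{k1, k2, k3}`. -/ def S : Finset (Fin 3 → ℤ) := {k1, k2, k3}
/-- Basis vector `e₁` of `ℂ³`. -/ def Ex : EuclideanSpace ℂ (Fin 3) := EuclideanSpace.single 0 1
/-- Basis vector `e₂` of `ℂ³`. -/ def Ey : EuclideanSpace ℂ (Fin 3) := EuclideanSpace.single 1 1
/-- Basis vector `e₃` of `ℂ³`. -/ def Ez : EuclideanSpace ℂ (Fin 3) := EuclideanSpace.single 2 1
/-- velocity coefficients: `u0 = (sin 2πx₂, sin 2πx₁, cos 2πx₁ + cos 2π(x₁+x₂))` -/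
def coef (k : Fin 3 → ℤ) : EuclideanSpace ℂ (Fin 3) :=
  if k = k1 then (-Complex.I) • Ey + Ez else if k = k2 then (-Complex.I) • Ex else Ez

/-- **The witness velocity** `u0 = (sin 2πx₂, sin 2πx₁, cos 2πx₁ + cos 2π(x₁+x₂))`. -/
def u0 : T3 → E3 := realTrigPoly S coef
/-- The pressure spectrum `{k3, k4}`. -/ def SP : Finset (Fin 3 → ℤ) := {k3, k4}
/-- pressure `p0 = cos 2πx₁ cos 2πx₂ = ½ cos 2π(x₁+x₂) + ½ cos 2π(x₁−x₂)` -/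
def p0 : T3 → ℝ := reTrigPoly SP (fun _ => (1 / 2 : ℂ))
/-- Spectrum bookkeeping. -/ theorem k1_not_mem : k1 ∉ ({k2, k3} : Finset (Fin 3 → ℤ)) := by decide
/-- Spectrum bookkeeping. -/ theorem k2_not_mem : k2 ∉ ({k3} : Finset (Fin 3 → ℤ)) := by decide
/-- Spectrum bookkeeping. -/ theorem k3_not_mem4 : k3 ∉ ({k4} : Finset (Fin 3 → ℤ)) := by decide
/-- Coefficient at `k1`. -/
theorem coef_k1 : coef k1 = (-Complex.I) • Ey + Ez := by rw [coef, if_pos rfl]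
/-- Coefficient at `k2`. -/
theorem coef_k2 : coef k2 = (-Complex.I) • Ex := by rw [coef, if_neg (by decide), if_pos rfl]
/-- Coefficient at `k3`. -/
theorem coef_k3 : coef k3 = Ez := by rw [coef, if_neg (by decide), if_neg (by decide)]
/-- `u0` is smooth. -/ theorem u0_smooth : Torus.IsSmooth u0 := isSmooth_realTrigPoly S coef
/-- `p0` is smooth. -/ theorem p0_smooth : Torus.IsSmooth p0 := isSmooth_reTrigPoly SP _
/-- `k · coef k = 0`: the witness is divergence-free mode by mode. -/
theorem coef_transversal : IsTransversal S coef := by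
  intro k hk
  simp only [S, Finset.mem_insert, Finset.mem_singleton] at hk
  rcases hk with rfl | rfl | rfl
  · rw [coef_k1]; simp [Ey, Ez, k1, Fin.sum_univ_three]
  · rw [coef_k2]; simp [Ex, k2]
  · rw [coef_k3]; simp [Ez, k3]
/-- `u0` is divergence-free. -/
theorem u0_divFree : Torus.IsDivFree u0 := isDivFree_realTrigPoly coef_transversal
/-- Coordinates of `∂ⱼ u0`. -/
theorem partialDeriv_u0_apply_coord (x : T3) (j i : Fin 3) :
    partialDeriv j u0 x i =
      (mFourier k1 x * ((2 * Real.pi * Complex.I * (k1 j)) • coef k1) i +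
        (mFourier k2 x * ((2 * Real.pi * Complex.I * (k2 j)) • coef k2) i +
          mFourier k3 x * ((2 * Real.pi * Complex.I * (k3 j)) • coef k3) i)).re := by
  rw [u0, partialDeriv_realTrigPoly, realTrigPoly_apply_coord, trigPoly_apply_coord, S,
    Finset.sum_insert k1_not_mem, Finset.sum_insert k2_not_mem, Finset.sum_singleton]
/-- explicit coordinates of `u0` -/
theorem u0_apply (x : T3) (i : Fin 3) :
    u0 x i = ![(mFourier k2 x).im, (mFourier k1 x).im, (mFourier k1 x).re + (mFourier k3 x).re] i := by
  rw [u0, realTrigPoly_apply_coord, trigPoly_apply_coord, S, Finset.sum_insert k1_not_mem,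
    Finset.sum_insert k2_not_mem, Finset.sum_singleton, coef_k1, coef_k2, coef_k3]
  fin_cases i <;> simp [Ex, Ey, Ez, Complex.mul_re, Complex.I_re, Complex.I_im]
/-- explicit convective term -/
theorem convect_u0_apply (x : T3) (i : Fin 3) :
    Torus.convect u0 u0 x i = (2 * Real.pi) *
      ![(mFourier k1 x).im * (mFourier k2 x).re, (mFourier k2 x).im * (mFourier k1 x).re,
        -((mFourier k2 x).im * ((mFourier k1 x).im + (mFourier k3 x).im) +
          (mFourier k1 x).im * (mFourier k3 x).im)] i := by
  unfold Torus.convect; rw [fderiv_apply_eq_sum_partialDeriv (u0_smooth.isContDiff (by simp))]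
  simp only [Fin.sum_univ_three, PiLp.add_apply, PiLp.smul_apply, smul_eq_mul, u0_apply,
    partialDeriv_u0_apply_coord, coef_k1, coef_k2, coef_k3]
  fin_cases i <;>
    simp [-mul_eq_mul_left_iff, -mul_eq_mul_right_iff, Ex, Ey, Ez, k1, k2, k3,
      Complex.mul_re, Complex.mul_im, Complex.I_re, Complex.I_im] <;> ring
/-- explicit pressure gradient -/
theorem gradient_p0_apply (x : T3) (i : Fin 3) :
    Torus.gradient p0 x i =
      ![-(Real.pi * ((mFourier k3 x).im + (mFourier k4 x).im)),
        -(Real.pi * ((mFourier k3 x).im - (mFourier k4 x).im)), 0] i := by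
  unfold p0; rw [gradient_reTrigPoly_apply, partialDeriv_reTrigPoly, reTrigPoly_eq_sum, SP,
    Finset.sum_insert k3_not_mem4, Finset.sum_singleton]
  fin_cases i <;>
    simp [k3, k4, Complex.mul_re, Complex.mul_im, Complex.I_re, Complex.I_im] <;> ring
/-- explicit pressure Laplacian -/
theorem laplacian_p0_apply (x : T3) :
    Torus.laplacian p0 x = -(4 * Real.pi ^ 2 * ((mFourier k3 x).re + (mFourier k4 x).re)) := by
  rw [p0, laplacian_reTrigPoly, reTrigPoly_eq_sum, SP, Finset.sum_insert k3_not_mem4,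
    Finset.sum_singleton]
  have h3 : freqNormSq k3 = 2 := by simp [freqNormSq, k3, Fin.sum_univ_three]; norm_num
  have h4 : freqNormSq k4 = 2 := by simp [freqNormSq, k4, Fin.sum_univ_three]; norm_num
  rw [h3, h4]
  have key : ∀ z : ℂ, (z * ((((-(4 * Real.pi ^ 2 * 2)) : ℝ) : ℂ) • (1 / 2 : ℂ))).re =
      -(4 * Real.pi ^ 2) * z.re := fun z => by
    rw [show (((-(4 * Real.pi ^ 2 * 2)) : ℝ) : ℂ) • (1 / 2 : ℂ) = ((-(4 * Real.pi ^ 2) : ℝ) : ℂ) by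
      rw [smul_eq_mul]; push_cast; ring, Complex.re_mul_ofReal]; ring
  rw [key, key]; ring
/-- `Im z = I (conj z - z) / 2` (no division by `I`). -/
theorem im_eq_I_mul (z : ℂ) : (z.im : ℂ) = Complex.I * (conj z - z) / 2 := by
  rw [Complex.im_eq_sub_conj]; field_simp; ring_nf; rw [Complex.I_sq]; ring

/-- The spectrum of the convective term. -/ def S6 : Finset (Fin 3 → ℤ) := {k1, k2, k3, k4, k5, k6}
/-- coefficients of the convective term -/
def cc (k : Fin 3 → ℤ) : EuclideanSpace ℂ (Fin 3) :=
  if k = k3 then (Real.pi : ℂ) • ((-Complex.I) • Ex + (-Complex.I) • Ey + Ez)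
  else if k = k4 then (Real.pi : ℂ) • ((-Complex.I) • Ex + Complex.I • Ey - Ez)
  else if k = k5 ∨ k = k6 then (Real.pi : ℂ) • Ez else (-(Real.pi : ℂ)) • Ez
/-- `cc k1`. -/ theorem cc_k1 : cc k1 = (-(Real.pi : ℂ)) • Ez := by
  rw [cc, if_neg (by decide), if_neg (by decide), if_neg (by decide)]
/-- `cc k2`. -/ theorem cc_k2 : cc k2 = (-(Real.pi : ℂ)) • Ez := by
  rw [cc, if_neg (by decide), if_neg (by decide), if_neg (by decide)]
/-- `cc k3`. -/ theorem cc_k3 : cc k3 = (Real.pi : ℂ) • ((-Complex.I) • Ex + (-Complex.I) • Ey + Ez) := by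
  rw [cc, if_pos rfl]
/-- `cc k4`. -/ theorem cc_k4 : cc k4 = (Real.pi : ℂ) • ((-Complex.I) • Ex + Complex.I • Ey - Ez) := by
  rw [cc, if_neg (by decide), if_pos rfl]
/-- `cc k5`. -/ theorem cc_k5 : cc k5 = (Real.pi : ℂ) • Ez := by
  rw [cc, if_neg (by decide), if_neg (by decide), if_pos (Or.inl rfl)]
/-- `cc k6`. -/ theorem cc_k6 : cc k6 = (Real.pi : ℂ) • Ez := by
  rw [cc, if_neg (by decide), if_neg (by decide), if_pos (Or.inr rfl)]
/-- Spectrum bookkeeping. -/ theorem nm1 : k1 ∉ ({k2, k3, k4, k5, k6} : Finset (Fin 3 → ℤ)) := by decide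
/-- Spectrum bookkeeping. -/ theorem nm2 : k2 ∉ ({k3, k4, k5, k6} : Finset (Fin 3 → ℤ)) := by decide
/-- Spectrum bookkeeping. -/ theorem nm3 : k3 ∉ ({k4, k5, k6} : Finset (Fin 3 → ℤ)) := by decide
/-- Spectrum bookkeeping. -/ theorem nm4 : k4 ∉ ({k5, k6} : Finset (Fin 3 → ℤ)) := by decide
/-- Spectrum bookkeeping. -/ theorem nm5 : k5 ∉ ({k6} : Finset (Fin 3 → ℤ)) := by decide
/-- Coordinates of the six-mode trigonometric polynomial. -/
theorem realTrigPoly_S6_apply (x : T3) (i : Fin 3) :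
    realTrigPoly S6 cc x i = (mFourier k1 x * cc k1 i + (mFourier k2 x * cc k2 i +
      (mFourier k3 x * cc k3 i + (mFourier k4 x * cc k4 i + (mFourier k5 x * cc k5 i +
        mFourier k6 x * cc k6 i))))).re := by
  rw [realTrigPoly_apply_coord, trigPoly_apply_coord, S6, Finset.sum_insert nm1,
    Finset.sum_insert nm2, Finset.sum_insert nm3, Finset.sum_insert nm4, Finset.sum_insert nm5,
    Finset.sum_singleton]

/-- **the convective term is a trigonometric polynomial** -/
theorem convect_eq : Torus.convect u0 u0 = realTrigPoly S6 cc := by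
  funext x; ext i
  rw [convect_u0_apply, realTrigPoly_S6_apply, cc_k1, cc_k2, cc_k3, cc_k4, cc_k5, cc_k6]
  fin_cases i <;>
    simp [-mul_eq_mul_left_iff, -mul_eq_mul_right_iff, Ex, Ey, Ez,
      Complex.mul_re, Complex.mul_im, Complex.I_re, Complex.I_im] <;>
  · apply Complex.ofReal_injective
    push_cast
    simp only [Complex.re_eq_add_conj, im_eq_I_mul, mFourier_eq_w, k1, k2, k3, k4, k5, k6,
      Matrix.cons_val_zero, Matrix.cons_val_one, Matrix.cons_val_two, Matrix.head_cons,
      Matrix.tail_cons, zpow_zero, zpow_one, zpow_neg, zpow_two, mul_one, one_mul, map_mul,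
      map_inv₀, conj_w]
    field_simp [w_ne_zero]
    ring_nf
    try (simp only [Complex.I_sq]; ring_nf)

/-- **the Poisson equation** `Δ p0 = -div ((u0·∇)u0)` -/
theorem poisson (x : T3) :
    Torus.laplacian p0 x = -Torus.divergence (Torus.convect u0 u0) x := by
  rw [convect_eq, divergence_realTrigPoly, laplacian_p0_apply, S6, Finset.sum_insert nm1,
    Finset.sum_insert nm2, Finset.sum_insert nm3, Finset.sum_insert nm4, Finset.sum_insert nm5,
    Finset.sum_singleton, cc_k1, cc_k2, cc_k3, cc_k4, cc_k5, cc_k6]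
  simp [-mul_eq_mul_left_iff, -mul_eq_mul_right_iff, Ex, Ey, Ez, Fin.sum_univ_three, k1, k2, k3,
    k4, k5, k6, Complex.mul_re, Complex.mul_im, Complex.I_re, Complex.I_im]
  ring
/-- `m = ⟪u0,(u0·∇)u0⟫ + ⟪u0, ∇p0⟫` -/
def mWit (x : T3) : ℝ := ⟪u0 x, Torus.convect u0 u0 x⟫ + ⟪u0 x, Torus.gradient p0 x⟫
/-- `q = ‖u0‖²` -/ def qWit (x : T3) : ℝ := ‖u0 x‖ ^ 2
/-- `m = (cos X + cos(X+Y)) · ((u0·∇)u0)₃` explicitly (`X = 2πx₁`, `Y = 2πx₂`). -/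
theorem mfun_eq (x : T3) : mWit x = ((mFourier k1 x).re + (mFourier k3 x).re) * ((2 * Real.pi) *
    -((mFourier k2 x).im * ((mFourier k1 x).im + (mFourier k3 x).im) +
      (mFourier k1 x).im * (mFourier k3 x).im)) := by
  simp only [mWit, PiLp.inner_apply, Fin.sum_univ_three, u0_apply, convect_u0_apply,
    gradient_p0_apply, RCLike.inner_apply, conj_trivial, Matrix.cons_val_zero, Matrix.cons_val_one,
    Matrix.cons_val_two, Matrix.head_cons, Matrix.tail_cons]
  apply Complex.ofReal_injective
  push_cast
  simp only [Complex.re_eq_add_conj, im_eq_I_mul, mFourier_eq_w, k1, k2, k3, k4,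
    Matrix.cons_val_zero, Matrix.cons_val_one, Matrix.cons_val_two, Matrix.head_cons,
    Matrix.tail_cons, zpow_zero, zpow_one, zpow_neg, mul_one, one_mul, map_mul, map_inv₀, conj_w]
  field_simp [w_ne_zero]
  ring_nf
/-- `q = sin²Y + sin²X + (cos X + cos(X+Y))²`. -/
theorem qfun_eq (x : T3) : qWit x = (mFourier k2 x).im ^ 2 + (mFourier k1 x).im ^ 2 +
    ((mFourier k1 x).re + (mFourier k3 x).re) ^ 2 := by
  simp only [qWit, EuclideanSpace.norm_sq_eq, Fin.sum_univ_three, u0_apply, Real.norm_eq_abs,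
    sq_abs, Matrix.cons_val_zero, Matrix.cons_val_one, Matrix.cons_val_two, Matrix.head_cons,
    Matrix.tail_cons]
/-- The 64 non-zero frequencies of `q·m` (generated by exact rational arithmetic). -/
def nL : Fin 64 → (Fin 3 → ℤ) :=
  ![![-5, -4, 0], ![-5, -3, 0], ![-5, -2, 0], ![-4, -5, 0], ![-4, -4, 0], ![-4, -3, 0], ![-4, -2, 0], ![-4, -1, 0], ![-4, 0, 0], ![-3, -4, 0], ![-3, -3, 0], ![-3, -2, 0], ![-3, -1, 0], ![-3, 0, 0], ![-3, 1, 0], ![-2, -5, 0], ![-2, -3, 0], ![-2, -2, 0], ![-2, 0, 0], ![-2, 1, 0], ![-2, 3, 0], ![-1, -4, 0], ![-1, -3, 0], ![-1, -2, 0], ![-1, -1, 0], ![-1, 0, 0], ![-1, 1, 0], ![-1, 2, 0], ![-1, 3, 0], ![0, -3, 0], ![0, -2, 0], ![0, -1, 0], ![0, 1, 0], ![0, 2, 0], ![0, 3, 0], ![1, -3, 0], ![1, -2, 0], ![1, -1, 0], ![1, 0, 0], ![1, 1, 0], ![1, 2, 0], ![1, 3, 0], ![1, 4, 0], ![2, -3,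 0], ![2, -1, 0], ![2, 0, 0], ![2, 2, 0], ![2, 3, 0], ![2, 5, 0], ![3, -1, 0], ![3, 0, 0], ![3, 1, 0], ![3, 2, 0], ![3, 3, 0], ![3, 4, 0], ![4, 0, 0], ![4, 1, 0], ![4, 2, 0], ![4, 3, 0], ![4, 4, 0], ![4, 5, 0], ![5, 2, 0], ![5, 3, 0], ![5, 4, 0]]
/-- The Fourier coefficients of `q·m/(2π)` at the frequencies `nL` (the mean is `1/8`). -/
def rL : Fin 64 → ℝ :=
  ![1/32, 3/32, 1/16, 1/32, 1/8, 1/8, -1/16, -5/32, -1/16, -1/16, -1/32, 5/16, 9/32, -1/32, -1/32, -1/32, 3/8, 5/8, -5/8, -3/8, 1/32, 1/32, -3/32, -5/16, 1/32, 1/32, -9/32, -1/16, 1/32, -1/32, -1/16, 1/32, 1/32, -1/16, -1/32, 1/32, -1/16, -9/32, 1/32, 1/32, -5/16, -3/32, 1/32, 1/32, -3/8, -5/8, 5/8, 3/8, -1/32, -1/32, -1/32, 9/32, 5/16, -1/32, -1/16, -1/16, -5/32, -1/16, 1/8, 1/8, 1/32, 1/16, 3/32, 1/32]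
/-- None of the 64 frequencies is zero. -/ theorem nL_ne_zero : ∀ j, nL j ≠ 0 := by decide
/-- **Fourier expansion of the integrand.** -/
theorem F_expansion (x : T3) : ((qWit x * mWit x : ℝ) : ℂ) =
    ((Real.pi / 4 : ℝ) : ℂ) + ∑ j : Fin 64, ((2 * Real.pi * rL j : ℝ) : ℂ) * mFourier (nL j) x := by
  rw [qfun_eq, mfun_eq]
  simp only [Fin.sum_univ_succ, Fin.sum_univ_zero, nL, rL, Matrix.cons_val_zero,
    Matrix.cons_val_succ, add_zero]
  push_cast
  simp only [Complex.re_eq_add_conj, im_eq_I_mul, mFourier_eq_w, k1, k2, k3,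
    Matrix.cons_val_zero, Matrix.cons_val_one, Matrix.cons_val_two, Matrix.head_cons,
    Matrix.tail_cons, zpow_zero, zpow_one, zpow_neg, zpow_two, mul_one, one_mul, map_mul, conj_w]
  have hI4 : Complex.I ^ 4 = 1 := by rw [show (4 : ℕ) = 2 + 2 by norm_num, pow_add, Complex.I_sq]; ring
  field_simp [w_ne_zero]
  ring_nf
  simp only [Complex.I_sq, hI4]
  ring_nf

/-- **The mean of the integrand**: `∫ ‖u0‖² m = π/4`. -/
theorem integral_F : ∫ x, qWit x * mWit x = Real.pi / 4 := by
  have h1 : (∫ x, ((qWit x * mWit x : ℝ) : ℂ)) = ((Real.pi / 4 : ℝ) : ℂ) := by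
    simp_rw [F_expansion]
    have hi : ∀ j : Fin 64, Integrable (fun x : T3 => ((2 * Real.pi * rL j : ℝ) : ℂ) * mFourier (nL j) x) :=
      fun j => (continuous_const.mul (mFourier (nL j)).continuous).integrable_unitAddTorus
    rw [integral_add (integrable_const _) (integrable_finsetSum _ fun j _ => hi j),
      integral_finsetSum _ fun j _ => hi j]
    simp [integral_const_mul, integral_mFourier, nL_ne_zero]
  rw [integral_complex_ofReal] at h1
  exact_mod_cast h1
/-- `|e_n(x)| = 1`. -/
theorem norm_mFourier_apply (n : Fin 3 → ℤ) (x : T3) : ‖mFourier n x‖ = 1 := by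
  rw [mFourier_eq_w]; simp [norm_zpow, w]
/-- `|cos| ≤ 1`. -/
theorem abs_re_le (n : Fin 3 → ℤ) (x : T3) : |(mFourier n x).re| ≤ 1 :=
  (Complex.abs_re_le_norm _).trans (norm_mFourier_apply n x).le
/-- `|sin| ≤ 1`. -/
theorem abs_im_le (n : Fin 3 → ℤ) (x : T3) : |(mFourier n x).im| ≤ 1 :=
  (Complex.abs_im_le_norm _).trans (norm_mFourier_apply n x).le
/-- `q ≥ 0`. -/
theorem qfun_nonneg (x : T3) : 0 ≤ qWit x := by
  unfold qWit; positivity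
/-- `q ≤ 6`. -/
theorem qfun_le (x : T3) : qWit x ≤ 6 := by
  rw [qfun_eq]
  have h1 : (mFourier k2 x).im ^ 2 ≤ 1 := (sq_le_one_iff_abs_le_one _).2 (abs_im_le k2 x)
  have h2 : (mFourier k1 x).im ^ 2 ≤ 1 := (sq_le_one_iff_abs_le_one _).2 (abs_im_le k1 x)
  have h3 : |(mFourier k1 x).re + (mFourier k3 x).re| ≤ 2 :=
    (abs_add_le _ _).trans (by linarith [abs_re_le k1 x, abs_re_le k3 x])
  have h4 : ((mFourier k1 x).re + (mFourier k3 x).re) ^ 2 ≤ 2 ^ 2 := by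
    rw [← sq_abs]; exact pow_le_pow_left₀ (abs_nonneg _) h3 2
  linarith
/-- `|m| ≤ 12π`. -/
theorem abs_mfun_le (x : T3) : |mWit x| ≤ 12 * Real.pi := by
  rw [mfun_eq]
  set a := (mFourier k2 x).im
  set b := (mFourier k1 x).im
  set e := (mFourier k3 x).im
  have ha : |a| ≤ 1 := abs_im_le k2 x
  have hb : |b| ≤ 1 := abs_im_le k1 x
  have he : |e| ≤ 1 := abs_im_le k3 x
  have hcd : |(mFourier k1 x).re + (mFourier k3 x).re| ≤ 2 :=
    (abs_add_le _ _).trans (by linarith [abs_re_le k1 x, abs_re_le k3 x])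
  have hbe : |b + e| ≤ 2 := (abs_add_le _ _).trans (by linarith)
  have h3 : |a * (b + e) + b * e| ≤ 3 :=
    calc |a * (b + e) + b * e| ≤ |a * (b + e)| + |b * e| := abs_add_le _ _
      _ = |a| * |b + e| + |b| * |e| := by rw [abs_mul, abs_mul]
      _ ≤ 1 * 2 + 1 * 1 := by gcongr
      _ = 3 := by norm_num
  rw [abs_mul, abs_mul, abs_neg, abs_of_pos (by positivity : (0:ℝ) < 2 * Real.pi)]
  calc _ ≤ 2 * (2 * Real.pi * 3) := by gcongr
    _ = 12 * Real.pi := by ring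
/-- `q²|m| ≤ 432π`. -/
theorem bound_pointwise (x : T3) : qWit x ^ 2 * |mWit x| ≤ 432 * Real.pi := by
  have hq : qWit x ^ 2 ≤ 6 ^ 2 := pow_le_pow_left₀ (qfun_nonneg x) (qfun_le x) 2
  calc qWit x ^ 2 * |mWit x| ≤ 6 ^ 2 * (12 * Real.pi) :=
        mul_le_mul hq (abs_mfun_le x) (abs_nonneg _) (by norm_num)
    _ = 432 * Real.pi := by ring
/-- `s − s² ≤ log(1+s) ≤ s` for `s ≥ 0`. -/
theorem log_one_add_bounds {s : ℝ} (hs : 0 ≤ s) :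
    s - s ^ 2 ≤ Real.log (1 + s) ∧ Real.log (1 + s) ≤ s := by
  have h1 : 0 < 1 + s := by linarith
  constructor
  · have h2 : s - s ^ 2 ≤ 1 - (1 + s)⁻¹ := by
      rw [show 1 - (1 + s)⁻¹ = s / (1 + s) by field_simp; ring, le_div_iff₀ h1]
      nlinarith [mul_nonneg hs (sq_nonneg s)]
    linarith [Real.one_sub_inv_le_log_of_pos h1]
  · linarith [Real.log_le_sub_one_of_pos h1]
/-- The log weight against its linearisation: `2sm − 2s²|m| ≤ 2 log(1+s) m`. -/
theorem key_pointwise {s m : ℝ} (hs : 0 ≤ s) :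
    2 * s * m - 2 * s ^ 2 * |m| ≤ 2 * Real.log (1 + s) * m := by
  obtain ⟨hlo, hhi⟩ := log_one_add_bounds hs
  rcases le_or_gt 0 m with hm | hm
  · rw [abs_of_nonneg hm]; nlinarith [mul_le_mul_of_nonneg_right hlo hm]
  · rw [abs_of_neg hm]
    nlinarith [mul_le_mul_of_nonpos_right hhi hm.le, mul_nonneg (sq_nonneg s) (neg_nonneg.2 hm.le)]
/-- `q` is continuous. -/
theorem continuous_qfun : Continuous qWit := (u0_smooth.continuous.norm).pow 2
/-- `m` is continuous. -/
theorem continuous_mfun : Continuous mWit :=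
  (u0_smooth.continuous.inner (u0_smooth.convect u0_smooth).continuous).add
    (u0_smooth.continuous.inner p0_smooth.gradient.continuous)

end L14

open L14 in
/-- **`¬ Step_L14Abs`: Lemma 14 p.26 is false at its field-level grain** — for the divergence-free
field `u0 = (sin 2πx₂, sin 2πx₁, cos 2πx₁ + cos 2π(x₁+x₂))` and its pressure `p0 = cos 2πx₁ cos 2πx₂`
(`Δp0 = −div((u0·∇)u0)`), `I_conv + I_press ≥ (2/η)(π/4) − 864π/η² > 0` at `η = 10⁴`.
[cite: Stanley2025, Lemma 14 p.26] -/
theorem not_Step_L14Abs : ¬ Literature.Claims.NS.Stanley2025.Step_L14Abs := by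
  intro h
  have h0 := h 10000 u0 p0 (by norm_num) u0_smooth u0_divFree p0_smooth poisson
  set L : T3 → ℝ := fun x => Real.log (1 + qWit x / 10000) with hL
  have hLc : Continuous L := by
    refine (continuous_const.add (continuous_qfun.div_const _)).log fun x => ?_
    exact (by linarith [qfun_nonneg x] : (0 : ℝ) < 1 + qWit x / 10000).ne'
  have hdF : ∀ x, dFeta 10000 (‖u0 x‖ ^ 2) = L x := fun x => rfl
  have hin1 : Continuous fun x => ⟪u0 x, Torus.convect u0 u0 x⟫ :=
    u0_smooth.continuous.inner (u0_smooth.convect u0_smooth).continuous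
  have hin2 : Continuous fun x => ⟪u0 x, Torus.gradient p0 x⟫ :=
    u0_smooth.continuous.inner p0_smooth.gradient.continuous
  have hf1c : Continuous fun x => 2 * dFeta 10000 (‖u0 x‖ ^ 2) * ⟪u0 x, Torus.convect u0 u0 x⟫ := by
    simp_rw [hdF]; exact (continuous_const.mul hLc).mul hin1
  have hf2c : Continuous fun x => 2 * dFeta 10000 (‖u0 x‖ ^ 2) * ⟪u0 x, Torus.gradient p0 x⟫ := by
    simp_rw [hdF]; exact (continuous_const.mul hLc).mul hin2
  have hI : ∫ x, 2 * L x * mWit x = 0 := by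
    have e : ∀ x, 2 * L x * mWit x = 2 * dFeta 10000 (‖u0 x‖ ^ 2) * ⟪u0 x, Torus.convect u0 u0 x⟫
        + 2 * dFeta 10000 (‖u0 x‖ ^ 2) * ⟪u0 x, Torus.gradient p0 x⟫ := fun x => by
      rw [hdF, mWit]; ring
    simp_rw [e]
    rw [integral_add hf1c.integrable_unitAddTorus hf2c.integrable_unitAddTorus]
    unfold Iconv Ipress at h0
    linarith
  have hB : ∀ x, 2 / 10000 * (qWit x * mWit x) - 2 / 10000 ^ 2 * (qWit x ^ 2 * |mWit x|)
      ≤ 2 * L x * mWit x := by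
    intro x
    have hs : 0 ≤ qWit x / 10000 := div_nonneg (qfun_nonneg x) (by norm_num)
    convert key_pointwise (m := mWit x) hs using 1
    ring
  have hBc : Continuous fun x => 2 / 10000 * (qWit x * mWit x)
      - 2 / 10000 ^ 2 * (qWit x ^ 2 * |mWit x|) := by have := continuous_qfun; have := continuous_mfun; fun_prop
  have hAc : Continuous fun x => 2 * L x * mWit x := (continuous_const.mul hLc).mul continuous_mfun
  have hmono := integral_mono hBc.integrable_unitAddTorus hAc.integrable_unitAddTorus fun x => hB x
  have hqm : Integrable (fun x => qWit x * mWit x) :=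
    (continuous_qfun.mul continuous_mfun).integrable_unitAddTorus
  have hqa : Integrable (fun x => qWit x ^ 2 * |mWit x|) :=
    ((continuous_qfun.pow 2).mul continuous_mfun.abs).integrable_unitAddTorus
  have hBval : ∫ x, (2 / 10000 * (qWit x * mWit x) - 2 / 10000 ^ 2 * (qWit x ^ 2 * |mWit x|))
      = 2 / 10000 * (Real.pi / 4) - 2 / 10000 ^ 2 * ∫ x, qWit x ^ 2 * |mWit x| := by
    rw [integral_sub (hqm.const_mul _) (hqa.const_mul _), integral_const_mul, integral_const_mul,
      integral_F]
  have hC : ∫ x, qWit x ^ 2 * |mWit x| ≤ 432 * Real.pi := by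
    simpa using integral_mono hqa (integrable_const (432 * Real.pi)) fun x => bound_pointwise x
  rw [hBval, hI] at hmono
  nlinarith [Real.pi_pos]

end Summit.NavierStokesRegularity.NavierStokesRegularity.Theorems.Stanley2025
end
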